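import Mathlib
import HarnessLib
import Summits.Ventures.LatticeQCDFlow.Scoring.WeightedBlockSumCLT
import Summits.Ventures.LatticeQCDFlow.Scoring.MultivariateCLT
import Summits.Ventures.LatticeQCDFlow.Scoring.DoeblinPowerGeometricEnvelope

/-!
# THE JOINT CENTRAL LIMIT THEOREM OF THE BATCH MEANS AT A FIXED NUMBER OF BATCHES, from any start:
# `(√b_n (B_{n,0} − πf), …, √b_n (B_{n,a−1} − πf)) ⇒ σ_f · N(0, I_a)` as `b_n → ∞`

HONEST FRAMING: exact (Metropolis-corrected) sampling algorithms for lattice gauge theory;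
figures of merit are autocorrelation/cost numbers at stated couplings and volumes; no
continuum-physics claim.

Venture `LatticeQCDFlow` (cell pub-lqcd), topic `Scoring`; FANOUT row 4 (`s0-u1-b`, GEN-32).
NEW WORK of the cell, not a published result; no definition is introduced; nothing is cited as a
fact.  For every kernel with a geometric sup-norm envelope `(A, ρ)` (every kernel one of whose
powers is Doeblin), every bounded measurable observable `f` and EVERY initial law, at a FIXED
number `a` of batches of length `b_n → ∞`, the vector of scaled centred batch sums
`V_n = (b_n^{-1/2} Σ_{r<b_n} f̄(X_{b_n j+r}))_{j<a}` (`f̄ = f − πf`) converges in distribution in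
`EuclideanSpace ℝ (Fin a)` to `√σ²_f • Z`, `Z ∼ stdGaussian` (`σ²_f` the Green–Kubo variance): the
`a` batch means are asymptotically INDEPENDENT Gaussians `N(πf, σ²_f/b_n)`, whatever the start.
This is the one-dimensional weighted CLT of `Scoring/WeightedBlockSumCLT.lean` for every weight
vector `t`, assembled by the tree's Cramér–Wold device (`Scoring/CramerWoldDevice.lean`); the limit's
projections `⟪t, √σ²_f • Z⟫ ∼ N(0, σ²_f ‖t‖²)` come from Mathlib's `stdGaussian` API
(`Scoring/MultivariateCLT.hasLaw_inner_of_isGaussian`).  It is the input of the Student / `χ²`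
calibration of binned error bars at a fixed number of bins.  Printed counterpart NAMED ONLY: the
method of batch means with a fixed number of batches (Schmeiser 1982; Glynn–Iglehart 1990;
Fishman 1978), nothing cited as a fact.

## Content (`π` invariant; `|f| ≤ C` measurable; `P_{μ₀}` from ANY `μ₀`)

* `hasLaw_inner_sqrt_smul_stdGaussian` — `Z ∼ stdGaussian`, `σ² ≥ 0`: `⟪t, √σ² • Z⟫ ∼ N(0, σ² Σ_j t_j²)`;
* **`chain_batchMeans_joint_clt_of_envelope`** — `V_n ⇒ √σ²_f • Z` under the envelope;
* **`chain_batchMeans_joint_clt_of_nHit`** — the same under an `m`-step Doeblin certificate.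

NOT CLAIMED: a growing number of batches (`Scoring/BatchMeansCLT.lean`); rates; unbounded `f`;
any number of ours.
-/

noncomputable section

namespace Summit.Ventures.LatticeQCDFlow.Scoring

open MeasureTheory ProbabilityTheory Filter Finset Preorder
open scoped ENNReal Topology RealInnerProductSpace

variable {Ω : Type*} [MeasurableSpace Ω]

section Envelope

variable {κ : Kernel Ω Ω} [IsMarkovKernel κ] {π : Measure Ω} [IsProbabilityMeasure π] {A ρ : ℝ}

/-! ### The joint CLT of the batch means (Cramér–Wold) -/

/-- For `Z ∼ stdGaussian` on `EuclideanSpace ℝ (Fin a)`, `σ² ≥ 0` and a weight vector `t`: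
`⟪t, √σ² • Z⟫ ∼ N(0, σ² Σ_j t_j²)`, the variance written as `(Σ_{j<a} u_j²) σ²` with
`u_j = t_j` (`j < a`). -/
theorem hasLaw_inner_sqrt_smul_stdGaussian {a : ℕ} {Ω' : Type*} [MeasurableSpace Ω']
    {P' : Measure Ω'} [IsProbabilityMeasure P'] {Z : Ω' → EuclideanSpace ℝ (Fin a)}
    (hZ : HasLaw Z (stdGaussian (EuclideanSpace ℝ (Fin a))) P') {σ2 : ℝ} (hσ2 : 0 ≤ σ2)
    (t : EuclideanSpace ℝ (Fin a)) :
    HasLaw (fun ω => ⟪t, Real.sqrt σ2 • Z ω⟫)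
      (gaussianReal 0 (Real.toNNReal ((∑ j ∈ Finset.range a, (fun j => if hj : j < a then t ⟨j, hj⟩ else 0) j ^ 2) * σ2))) P' := by
  have h1 := CardConsistency.hasLaw_inner_of_isGaussian hZ t
  have hmean : (stdGaussian (EuclideanSpace ℝ (Fin a)))[fun x => ⟪t, x⟫] = 0 :=
    integral_strongDual_stdGaussian (E := EuclideanSpace ℝ (Fin a)) (InnerProductSpace.toDualMap ℝ _ t)
  have hvar : Var[fun x => ⟪t, x⟫; stdGaussian (EuclideanSpace ℝ (Fin a))] = ‖t‖ ^ 2 := by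
    have h := variance_dual_stdGaussian (E := EuclideanSpace ℝ (Fin a)) (InnerProductSpace.toDualMap ℝ _ t)
    refine h.trans ?_
    rw [LinearIsometry.norm_map]
  rw [hmean, hvar] at h1
  have h2 := gaussianReal_const_mul h1 (Real.sqrt σ2)
  rw [mul_zero] at h2
  have hsum : ∑ j ∈ Finset.range a, (fun j => if hj : j < a then t ⟨j, hj⟩ else 0) j ^ 2 = ‖t‖ ^ 2 := by
    rw [EuclideanSpace.real_norm_sq_eq, Finset.sum_range]
    refine Finset.sum_congr rfl fun i _ => ?_
    simp only [dif_pos i.2]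
  have h3 := h2.congr (Y := fun ω => ⟪t, Real.sqrt σ2 • Z ω⟫)
    (ae_of_all _ fun ω => by simp only [real_inner_smul_right])
  convert h3 using 3
  rw [hsum]
  apply NNReal.eq
  rw [Real.coe_toNNReal _ (mul_nonneg (sq_nonneg _) hσ2), NNReal.coe_mul, NNReal.coe_mk,
    Real.coe_toNNReal _ (sq_nonneg _), Real.sq_sqrt hσ2, mul_comm]

/-- **THE JOINT CLT OF THE BATCH MEANS AT A FIXED NUMBER OF BATCHES, FROM ANY START.**  `π`
invariant, envelope `(A, ρ)` (`0 ≤ A`, `0 ≤ ρ < 1`), `|f| ≤ C` measurable, `f̄ = f − πf`, `σ²_f` the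
Green–Kubo variance; `a` FIXED, `b_n → ∞`, `μ₀` ANY initial law; `Z ∼ stdGaussian` on
`EuclideanSpace ℝ (Fin a)`.  Then the vector of scaled centred batch sums
`(b_n^{-1/2} Σ_{r<b_n} f̄(X_{b_n j + r}))_{j<a}` converges in distribution to `√σ²_f • Z`: the `a` batch
means are asymptotically independent `N(πf, σ²_f/b_n)`. -/
theorem chain_batchMeans_joint_clt_of_envelope (hπ : Kernel.Invariant κ π)
    (henv : ∀ (g : Ω → ℝ), Measurable g → ∀ (Cg : ℝ), (∀ x, |g x| ≤ Cg) →
      ∀ (t : ℕ) (x : Ω), |(kop κ)^[t] g x - ∫ y, g y ∂π| ≤ 2 * Cg * (A * ρ ^ t))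
    (hA : 0 ≤ A) (hρ0 : 0 ≤ ρ) (hρ1 : ρ < 1)
    {f : Ω → ℝ} (hf : Measurable f) {C : ℝ} (hC : ∀ x, |f x| ≤ C)
    (μ₀ : Measure Ω) [IsProbabilityMeasure μ₀] (a : ℕ) {b : ℕ → ℕ} (hb : Tendsto b atTop atTop)
    {Ω' : Type*} [MeasurableSpace Ω'] {P' : Measure Ω'} [IsProbabilityMeasure P']
    {Z : Ω' → EuclideanSpace ℝ (Fin a)} (hZ : HasLaw Z (stdGaussian (EuclideanSpace ℝ (Fin a))) P')
    [IsProbabilityMeasure (Kernel.trajMeasure (X := fun _ : ℕ => Ω) (μ₀)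
          (fun n : ℕ => κ.comap (fun h' : (i : ↥(Finset.Iic n)) → Ω => h' ⟨n, Finset.mem_Iic.2 le_rfl⟩)
            (measurable_pi_apply _)))] :
    TendstoInDistribution (fun (n : ℕ) (x : ℕ → Ω) =>
        (WithLp.toLp 2 (fun j : Fin a =>
          (∑ r ∈ Finset.range (b n), (f (x (b n * j + r)) - ∫ z, f z ∂π)) / Real.sqrt (b n))
            : EuclideanSpace ℝ (Fin a)))
      atTop (fun ω => Real.sqrt (((∫ y, (f y - ∫ z, f z ∂(π)) ^ 2 ∂(π)) + 2 * ∑' k, ∫ y, (f y - ∫ z, f z ∂(π)) * (kop (κ))^[k + 1] (fun y => f y - ∫ z, f z ∂(π)) y ∂(π))) • Z ω)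
      (fun _ => (Kernel.trajMeasure (X := fun _ : ℕ => Ω) (μ₀)
            (fun n : ℕ => κ.comap (fun h' : (i : ↥(Finset.Iic n)) → Ω => h' ⟨n, Finset.mem_Iic.2 le_rfl⟩)
              (measurable_pi_apply _)))) P' := by
  set P := (Kernel.trajMeasure (X := fun _ : ℕ => Ω) (μ₀)
        (fun n : ℕ => κ.comap (fun h' : (i : ↥(Finset.Iic n)) → Ω => h' ⟨n, Finset.mem_Iic.2 le_rfl⟩)
          (measurable_pi_apply _))) with hP
  set σ2 : ℝ := ((∫ y, (f y - ∫ z, f z ∂(π)) ^ 2 ∂(π)) + 2 * ∑' k, ∫ y, (f y - ∫ z, f z ∂(π)) * (kop (κ))^[k + 1] (fun y => f y - ∫ z, f z ∂(π)) y ∂(π)) with hσ2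
  have hσ2nn : 0 ≤ σ2 := greenKubo_nonneg_of_envelope hπ henv hρ0 hρ1 hf hC
  obtain ⟨hfbm, -, -⟩ := centred_observable_bounds π hf hC
  have hX : ∀ n, AEMeasurable (fun x : ℕ → Ω => (WithLp.toLp 2 (fun j : Fin a =>
      (∑ r ∈ Finset.range (b n), (f (x (b n * j + r)) - ∫ z, f z ∂π)) / Real.sqrt (b n))
        : EuclideanSpace ℝ (Fin a))) P := fun n =>
    ((WithLp.measurable_toLp 2 _).comp (measurable_pi_lambda _ fun j =>
      (Finset.measurable_sum _ fun r _ => hfbm.comp (measurable_pi_apply _)).div_const _)).aemeasurable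
  have hZ' : AEMeasurable (fun ω => Real.sqrt σ2 • Z ω) P' :=
    (measurable_const_smul (Real.sqrt σ2)).comp_aemeasurable hZ.aemeasurable
  refine CardConsistency.tendstoInDistribution_of_forall_inner (Ω := fun _ => ℕ → Ω)
    (P := fun _ => P) hX hZ' fun t => ?_
  set u : ℕ → ℝ := fun j => if hj : j < a then t ⟨j, hj⟩ else 0 with hu
  have hY := hasLaw_inner_sqrt_smul_stdGaussian hZ hσ2nn t
  have hclt := chain_weightedBlockSum_clt_of_envelope hπ henv hA hρ0 hρ1 hf hC μ₀ u a hb hY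
  refine hclt.congr (fun n => ae_of_all _ fun x => ?_) (ae_of_all _ fun ω => rfl)
  have hufin : ∀ i : Fin a, u i = t i := fun i => by simp only [hu, dif_pos i.2]
  show (∑ j ∈ Finset.range a, u j * ∑ r ∈ Finset.range (b n), (f (x (b n * j + r)) - ∫ z, f z ∂π))
        / Real.sqrt (b n)
      = ⟪t, (WithLp.toLp 2 (fun j : Fin a =>
          (∑ r ∈ Finset.range (b n), (f (x (b n * j + r)) - ∫ z, f z ∂π)) / Real.sqrt (b n))
            : EuclideanSpace ℝ (Fin a))⟫
  rw [Finset.sum_div, Finset.sum_range]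
  simp only [PiLp.inner_apply, RCLike.inner_apply, conj_trivial, hufin]
  refine Finset.sum_congr rfl fun i _ => ?_
  ring

end Envelope

section DoeblinPower

variable {κ : Kernel Ω Ω} [IsMarkovKernel κ] {π : Measure Ω} [IsProbabilityMeasure π]
  {ν : Measure Ω} [IsProbabilityMeasure ν] {ε : ℝ≥0∞} {m : ℕ}

/-- **THE JOINT CLT OF THE BATCH MEANS UNDER A DOEBLIN POWER.**  `π` invariant,
`(nHit κ m)(x, ·) ≥ ε ν` (`0 < ε ≤ 1`, `0 < m`), `|f| ≤ C` measurable; `a` fixed, `b_n → ∞`, any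
start, `Z ∼ stdGaussian` on `EuclideanSpace ℝ (Fin a)`: the vector of scaled centred batch sums
converges in distribution to `√σ²_f • Z`. -/
theorem chain_batchMeans_joint_clt_of_nHit (hπ : Kernel.Invariant κ π)
    (hmin : ∀ x {B : Set Ω}, MeasurableSet B → ε * ν B ≤ Exactness.nHit κ m x B) (hε0 : 0 < ε)
    (hε1 : ε ≤ 1) (hm : 0 < m)
    {f : Ω → ℝ} (hf : Measurable f) {C : ℝ} (hC : ∀ x, |f x| ≤ C)
    (μ₀ : Measure Ω) [IsProbabilityMeasure μ₀] (a : ℕ) {b : ℕ → ℕ} (hb : Tendsto b atTop atTop)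
    {Ω' : Type*} [MeasurableSpace Ω'] {P' : Measure Ω'} [IsProbabilityMeasure P']
    {Z : Ω' → EuclideanSpace ℝ (Fin a)} (hZ : HasLaw Z (stdGaussian (EuclideanSpace ℝ (Fin a))) P')
    [IsProbabilityMeasure (Kernel.trajMeasure (X := fun _ : ℕ => Ω) (μ₀)
          (fun n : ℕ => κ.comap (fun h' : (i : ↥(Finset.Iic n)) → Ω => h' ⟨n, Finset.mem_Iic.2 le_rfl⟩)
            (measurable_pi_apply _)))] :
    TendstoInDistribution (fun (n : ℕ) (x : ℕ → Ω) =>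
        (WithLp.toLp 2 (fun j : Fin a =>
          (∑ r ∈ Finset.range (b n), (f (x (b n * j + r)) - ∫ z, f z ∂π)) / Real.sqrt (b n))
            : EuclideanSpace ℝ (Fin a)))
      atTop (fun ω => Real.sqrt (((∫ y, (f y - ∫ z, f z ∂(π)) ^ 2 ∂(π)) + 2 * ∑' k, ∫ y, (f y - ∫ z, f z ∂(π)) * (kop (κ))^[k + 1] (fun y => f y - ∫ z, f z ∂(π)) y ∂(π))) • Z ω)
      (fun _ => (Kernel.trajMeasure (X := fun _ : ℕ => Ω) (μ₀)
            (fun n : ℕ => κ.comap (fun h' : (i : ↥(Finset.Iic n)) → Ω => h' ⟨n, Finset.mem_Iic.2 le_rfl⟩)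
              (measurable_pi_apply _)))) P' := by
  obtain ⟨A, ρ, hA, hρ0, hρ1, henv⟩ := exists_geometricEnvelope_of_nHit hmin hε0 hε1 hm hπ
  exact chain_batchMeans_joint_clt_of_envelope hπ henv hA hρ0 hρ1 hf hC μ₀ a hb hZ

end DoeblinPower

end Summit.Ventures.LatticeQCDFlow.Scoring

end
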